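import Summits.CriticalPhenomena.SAWScalingLimit.Theorems.SAWDevelopingMapInteriorFlatteningLiouvilleExtraction
import Summits.CriticalPhenomena.SAWScalingLimit.Theorems.SAWDevelopingMapInteriorFlatteningLiouvilleReductionA

/-!
# Uniqueness reduction for `InteriorFlattening` (S7), part B: uniform convergence of clean alive rows

Crux `stmt-CriticalPhenomena-8297`
(`Summit.CriticalPhenomena.SAWScalingLimit.Theses.SAWDevelopingMap.InteriorFlattening`), line
`liouville-local-limits`, registered stub `stub_uniquenessReduction` (S7, lead `c1`); second
helper file (part A: `…LiouvilleReductionA`).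

**The compactness step.** Suppose every picture limit equals a fixed field `Ψ`
(`∀ G ∈ PicLimits, G = Ψ`; this is `PicLimits.Subsingleton` when `PicLimits` is non-empty, and
holds for ANY `Ψ` when it is empty). Then the normalised fields of good, clean, ALIVE picture
domains converge to `Ψ` UNIFORMLY (`uniform_clean_rows`): for every comparison radius `r` and
`δ > 0` there is `j` such that every good `j`-clean picture `P ∈ Pic S`, `S ≥ j`, with
`m_S(P) ≠ 0` has `‖F_P(e)/m_S(P) - Ψ(e)‖ ≤ δ` on `innerEdges r`. Otherwise violators with
cleanliness radius `→ ∞` exist; one comparison edge is violated infinitely often (pigeonhole on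
the finite set `innerEdges r`); the normalised fields are edgewise bounded (lattice Harnack in
the picture domains, which are admissible configurations deep at `O`, part A); a pointwise
convergent subsequence (diagonal extraction) is an element of `PicLimits` at distance `≥ δ` from
`Ψ` at that edge — a contradiction.

Combined with the topological lemma of part A and the dead rows (a clean good picture with
`m_S(P) = 0` has `F_P = 0` on `innerEdges r`, Harnack again) this gives the ROW ESTIMATE the
superposition argument consumes (`clean_row_estimate`): for `S` large and every `s̄`-clean
picture, `‖amp·F_P(e) - amp·m_S(P)·Ψ(e)‖ ≤ δ |amp| |m_S(P)|` on `innerEdges r`, whatever the far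
configuration `(D, ρ)`.

The two analytic inputs are taken here as explicit hypotheses, in the exact form in which the
sibling helper files of the line state them: the lattice Harnack bound under bulk no-fold
(`‖F(z)‖ ≤ C(z) ‖M(O)‖` for deep configurations; file `…LiouvilleHarnack`) and the diagonal
extraction of pointwise convergent subsequences of edgewise bounded lattice fields (registered
sub-goal `extraction_subseq_tendsto` of `…LiouvilleExtraction`, whose elementary sequence lemmas
are used here directly). They are discharged in the file proving the stub.
-/

noncomputable section

open scoped BigOperators Classical Topology
open Filter Literature.Probability.LatticeModels Literature.Probability.RandomPlanarGeometry.SAW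

namespace Summit.CriticalPhenomena.SAWScalingLimit.Theorems.InteriorFlattening.Liouville

namespace Reduction

/-! ### Pigeonhole along a sequence -/

/-- A sequence with values in a finite set takes one value frequently. -/
theorem exists_frequently_eq {α : Type*} {s : Finset α} {f : ℕ → α} (hf : ∀ n, f n ∈ s) :
    ∃ a ∈ s, ∃ᶠ n in atTop, f n = a := by
  by_contra h
  push Not at h
  have hall : ∀ᶠ n in atTop, ∀ a ∈ s, f n ≠ a :=
    (Filter.eventually_all_finset s).2 fun a ha => h a ha
  obtain ⟨n, hn⟩ := hall.exists
  exact hn (f n) (hf n) rfl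

/-! ### Harnack in picture domains -/

/-- **Harnack in a clean good picture domain.** If `‖F(z)‖ ≤ C ‖M(O)‖` holds for admissible
configurations that are `N`-deep at `O`, then it holds for the field of every good `s̄`-clean
picture `P ∈ Pic S` with `N ≤ s̄ ≤ S`. -/
theorem norm_picField_le {z : Sym2 HexVertex} {C N : ℝ}
    (hCN : ∀ (Λ : Finset HexVertex) (a : Sym2 HexVertex) (n : ℝ), N ≤ n →
      hexDomainSimplyConnected Λ → a ∈ hexDomainBoundary Λ → Deep Λ O n →
        ‖obs Λ a z‖ ≤ C * ‖obsMono Λ a‖)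
    {S sbar : ℝ} {P : Picture} (hP : P ∈ Pic S) (hg : GoodPic S P) (hc : Clean sbar P)
    (hle : sbar ≤ S) (hN : N ≤ sbar) : ‖picField S P z‖ ≤ C * ‖picMono S P‖ := by
  obtain ⟨hsc, hroot, hdeep⟩ := picDom_admissible hP hg hc hle
  exact hCN _ _ sbar hN hsc hroot hdeep

/-- **Harnack in clean good picture domains** (registered sub-goal of the crux, carried by this
file; the binder-free form of `norm_picField_le`). -/
theorem harnack_picDom :
    ∀ (z : Sym2 HexVertex) (C N S sbar : ℝ) (P : Picture),
      (∀ (Λ : Finset HexVertex) (a : Sym2 HexVertex) (n : ℝ), N ≤ n →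
        hexDomainSimplyConnected Λ → a ∈ hexDomainBoundary Λ → Deep Λ O n →
          ‖obs Λ a z‖ ≤ C * ‖obsMono Λ a‖) →
      P ∈ Pic S → GoodPic S P → Clean sbar P → sbar ≤ S → N ≤ sbar →
        ‖picField S P z‖ ≤ C * ‖picMono S P‖ := by
  intro z C N S sbar P hCN hP hg hc hle hN
  exact norm_picField_le hCN hP hg hc hle hN

/-! ### Uniform convergence of clean alive rows -/

/-- **Uniform convergence of clean alive rows** (the compactness step of S7). Under the lattice
Harnack bound and diagonal extraction, if every picture limit equals `Ψ` then for every `r` and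
`δ > 0` there is `j` such that every good `j`-clean ALIVE picture `P ∈ Pic S`, `S ≥ j`,
satisfies `‖F_P(e)/m_S(P) - Ψ(e)‖ ≤ δ` on `innerEdges r`. -/
theorem uniform_clean_rows
    (hH : ∀ z ∈ hexGraph.edgeSet, ∃ C N : ℝ, ∀ (Λ : Finset HexVertex) (a : Sym2 HexVertex) (n : ℝ),
      N ≤ n → hexDomainSimplyConnected Λ → a ∈ hexDomainBoundary Λ → Deep Λ O n →
        ‖obs Λ a z‖ ≤ C * ‖obsMono Λ a‖)
    (hE : ∀ (H : ℕ → Sym2 HexVertex → ℂ), (∀ z, ∃ B : ℝ, ∀ n, ‖H n z‖ ≤ B) →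
      ∃ φ : ℕ → ℕ, StrictMono φ ∧ ∃ G : Sym2 HexVertex → ℂ,
        ∀ z, Tendsto (fun n => H (φ n) z) atTop (𝓝 (G z)))
    {Ψ : Sym2 HexVertex → ℂ} (hΨ : ∀ G ∈ PicLimits, G = Ψ) (r : ℝ) {δ : ℝ} (hδ : 0 < δ) :
    ∃ j : ℕ, ∀ S : ℝ, (j : ℝ) ≤ S → ∀ P ∈ Pic S, GoodPic S P → Clean (j : ℝ) P →
      picMono S P ≠ 0 → ∀ e ∈ innerEdges r, ‖picField S P e / picMono S P - Ψ e‖ ≤ δ := by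
  by_contra h
  push Not at h
  choose S hS P hP hgood hclean hmono e he hviol using h
  -- one comparison edge is violated infinitely often
  obtain ⟨e₀, he₀, hfreq⟩ := exists_frequently_eq he
  obtain ⟨φ₁, hφ₁, hφ₁e⟩ := extraction_of_frequently_atTop hfreq
  have hedge₀ : e₀ ∈ hexGraph.edgeSet := mem_edgeSet_of_mem_innerEdges he₀
  -- the normalised fields along `φ₁`, set to `0` off the edge set
  set H : ℕ → Sym2 HexVertex → ℂ := fun n z =>
    if z ∈ hexGraph.edgeSet then picField (S (φ₁ n)) (P (φ₁ n)) z / picMono (S (φ₁ n)) (P (φ₁ n))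
    else 0 with hHdef
  -- edgewise boundedness (Harnack in the picture domains)
  have hbound : ∀ z, ∃ B : ℝ, ∀ n, ‖H n z‖ ≤ B := by
    intro z
    by_cases hz : z ∈ hexGraph.edgeSet
    · obtain ⟨C, N, hCN⟩ := hH z hz
      refine Extraction.exists_forall_le_of_eventually (N := ⌈N⌉₊) (B := C) fun n hn => ?_
      have hNn : N ≤ (φ₁ n : ℝ) :=
        (Nat.le_ceil N).trans (by exact_mod_cast hn.trans (hφ₁.id_le n))
      have hF := norm_picField_le hCN (hP (φ₁ n)) (hgood (φ₁ n)) (hclean (φ₁ n)) (hS (φ₁ n)) hNn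
      have hm : 0 < ‖picMono (S (φ₁ n)) (P (φ₁ n))‖ := norm_pos_iff.2 (hmono (φ₁ n))
      simp only [hHdef, if_pos hz, norm_div]
      rw [div_le_iff₀ hm]
      exact hF
    · exact ⟨0, fun n => by simp [hHdef, if_neg hz]⟩
  -- diagonal extraction
  obtain ⟨φ₂, hφ₂, G, hG⟩ := hE H hbound
  have hφ : StrictMono (φ₁ ∘ φ₂) := hφ₁.comp hφ₂
  -- the limit is a picture limit
  have hGmem : G ∈ PicLimits := by
    refine ⟨fun z hz => ?_, fun n => S (φ₁ (φ₂ n)), fun n => P (φ₁ (φ₂ n)), fun n => ?_, fun n => ?_,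
      fun z hz => ?_⟩
    · have h0 : Tendsto (fun n => H (φ₂ n) z) atTop (𝓝 0) := by
        simp only [hHdef, if_neg hz]
        exact tendsto_const_nhds
      exact tendsto_nhds_unique (hG z) h0
    · have hle : n ≤ φ₁ (φ₂ n) := hφ.id_le n
      have hle' : (n : ℝ) ≤ (φ₁ (φ₂ n) : ℝ) := by exact_mod_cast hle
      exact ⟨hle'.trans (hS _), hP _, hgood _, clean_antitone hle' (hclean _)⟩
    · exact hmono _
    · refine (hG z).congr fun n => ?_
      simp only [hHdef, if_pos hz]
  have hGΨ : G = Ψ := hΨ G hGmem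
  -- but at `e₀` every term is `δ`-far from `Ψ e₀`
  have hfar : ∀ n, δ < ‖H (φ₂ n) e₀ - Ψ e₀‖ := by
    intro n
    have := hviol (φ₁ (φ₂ n))
    rw [hφ₁e (φ₂ n)] at this
    simpa only [hHdef, if_pos hedge₀] using this
  have hlim : Tendsto (fun n => ‖H (φ₂ n) e₀ - Ψ e₀‖) atTop (𝓝 ‖G e₀ - Ψ e₀‖) :=
    ((hG e₀).sub tendsto_const_nhds).norm
  have hδle : δ ≤ ‖G e₀ - Ψ e₀‖ := ge_of_tendsto' hlim fun n => (hfar n).le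
  rw [hGΨ, sub_self, norm_zero] at hδle
  exact absurd hδle (not_le.2 hδ)

/-! ### The row estimate -/

/-- A uniform depth beyond which the Harnack bound holds at every edge of `innerEdges r`. -/
theorem exists_uniform_harnack_depth
    (hH : ∀ z ∈ hexGraph.edgeSet, ∃ C N : ℝ, ∀ (Λ : Finset HexVertex) (a : Sym2 HexVertex) (n : ℝ),
      N ≤ n → hexDomainSimplyConnected Λ → a ∈ hexDomainBoundary Λ → Deep Λ O n →
        ‖obs Λ a z‖ ≤ C * ‖obsMono Λ a‖)
    (r : ℝ) :
    ∃ Nr : ℝ, ∀ e ∈ innerEdges r, ∃ C : ℝ, ∀ (Λ : Finset HexVertex) (a : Sym2 HexVertex) (n : ℝ),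
      Nr ≤ n → hexDomainSimplyConnected Λ → a ∈ hexDomainBoundary Λ → Deep Λ O n →
        ‖obs Λ a e‖ ≤ C * ‖obsMono Λ a‖ := by
  have h' : ∀ z : Sym2 HexVertex, ∃ C N : ℝ, z ∈ hexGraph.edgeSet →
      ∀ (Λ : Finset HexVertex) (a : Sym2 HexVertex) (n : ℝ), N ≤ n → hexDomainSimplyConnected Λ →
        a ∈ hexDomainBoundary Λ → Deep Λ O n → ‖obs Λ a z‖ ≤ C * ‖obsMono Λ a‖ := by
    intro z
    by_cases hz : z ∈ hexGraph.edgeSet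
    · obtain ⟨C, N, h⟩ := hH z hz
      exact ⟨C, N, fun _ => h⟩
    · exact ⟨0, 0, fun h => absurd h hz⟩
  choose C N hCN using h'
  refine ⟨∑ e ∈ innerEdges r, max (N e) 0, fun e he => ⟨C e, fun Λ a n hn hsc ha hd => ?_⟩⟩
  have hNe : N e ≤ ∑ e' ∈ innerEdges r, max (N e') 0 :=
    (le_max_left _ _).trans
      (Finset.single_le_sum (f := fun e' => max (N e') 0) (fun _ _ => le_max_right _ _) he)
  exact hCN e (mem_edgeSet_of_mem_innerEdges he) Λ a n (hNe.trans hn) hsc ha hd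

/-- **The row estimate** (parts (i) + (ii) of S7 packaged for the superposition). Under the
lattice Harnack bound and diagonal extraction, if every picture limit equals `Ψ`, then for
every `r` and `δ > 0` there are a cleanliness radius `s̄ ≥ r` and a scale `S₃` such that for
all `S ≥ S₃` with `s̄ ≤ S`, every `s̄`-clean picture `P ∈ Pic S`, every far configuration
`(D, ρ)` and every `e ∈ innerEdges r`:
`‖amp·F_P(e) - amp·m_S(P)·Ψ(e)‖ ≤ δ |amp| |m_S(P)|`. (Unrealised pictures: `amp = 0`; head
visited: `F_P ≡ 0`; otherwise the picture is good by the topological lemma, and then it is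
either dead — `m_S(P) = 0` forces `F_P(e) = 0` by Harnack — or alive, where `uniform_clean_rows`
applies.) -/
theorem clean_row_estimate
    (hH : ∀ z ∈ hexGraph.edgeSet, ∃ C N : ℝ, ∀ (Λ : Finset HexVertex) (a : Sym2 HexVertex) (n : ℝ),
      N ≤ n → hexDomainSimplyConnected Λ → a ∈ hexDomainBoundary Λ → Deep Λ O n →
        ‖obs Λ a z‖ ≤ C * ‖obsMono Λ a‖)
    (hE : ∀ (H : ℕ → Sym2 HexVertex → ℂ), (∀ z, ∃ B : ℝ, ∀ n, ‖H n z‖ ≤ B) →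
      ∃ φ : ℕ → ℕ, StrictMono φ ∧ ∃ G : Sym2 HexVertex → ℂ,
        ∀ z, Tendsto (fun n => H (φ n) z) atTop (𝓝 (G z)))
    {Ψ : Sym2 HexVertex → ℂ} (hΨ : ∀ G ∈ PicLimits, G = Ψ) (r : ℝ) {δ : ℝ} (hδ : 0 < δ) :
    ∃ sbar : ℝ, r ≤ sbar ∧ ∀ S : ℝ, sbar ≤ S → ∀ P ∈ Pic S, Clean sbar P →
      ∀ (D : Finset HexVertex) (ρ : Sym2 HexVertex), ∀ e ∈ innerEdges r,
        ‖amp D ρ S P * picField S P e - amp D ρ S P * picMono S P * Ψ e‖ ≤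
          δ * (‖amp D ρ S P‖ * ‖picMono S P‖) := by
  obtain ⟨j, hj⟩ := uniform_clean_rows hH hE hΨ r hδ
  obtain ⟨Nr, hNr⟩ := exists_uniform_harnack_depth hH r
  refine ⟨max (max r j) Nr, (le_max_left _ _).trans (le_max_left _ _), ?_⟩
  intro S hS P hP hc D ρ e he
  have hjs : (j : ℝ) ≤ max (max r (j : ℝ)) Nr := (le_max_right _ _).trans (le_max_left _ _)
  have hNs : Nr ≤ max (max r (j : ℝ)) Nr := le_max_right _ _
  by_cases hamp : amp D ρ S P = 0
  · simp [hamp]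
  by_cases h2 : P.2.2 ∈ P.1
  · simp [picField_eq_zero_of_mem hP h2, picMono_eq_zero_of_mem hP h2]
  have hgood : GoodPic S P := goodPic_of_amp_ne_zero D ρ S P hP hamp h2
  by_cases hm : picMono S P = 0
  · -- dead row: the field vanishes on `innerEdges r`
    obtain ⟨C, hC⟩ := hNr e he
    have hF : ‖picField S P e‖ ≤ C * ‖picMono S P‖ :=
      norm_picField_le hC hP hgood hc hS hNs
    rw [hm, norm_zero, mul_zero] at hF
    have hF0 : picField S P e = 0 := norm_le_zero_iff.1 hF
    simp [hF0, hm]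
  · -- alive row: uniform convergence
    have hrow := hj S (hjs.trans hS) P hP hgood (clean_antitone hjs hc) hm e he
    have hid : amp D ρ S P * picField S P e - amp D ρ S P * picMono S P * Ψ e =
        amp D ρ S P * picMono S P * (picField S P e / picMono S P - Ψ e) := by
      field_simp
    rw [hid, norm_mul, norm_mul]
    calc ‖amp D ρ S P‖ * ‖picMono S P‖ * ‖picField S P e / picMono S P - Ψ e‖
        ≤ ‖amp D ρ S P‖ * ‖picMono S P‖ * δ :=
          mul_le_mul_of_nonneg_left hrow (mul_nonneg (norm_nonneg _) (norm_nonneg _))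
      _ = δ * (‖amp D ρ S P‖ * ‖picMono S P‖) := by ring

end Reduction

end Summit.CriticalPhenomena.SAWScalingLimit.Theorems.InteriorFlattening.Liouville

end
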